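import Summits.ValiantsHypothesis.ValiantsHypothesis.Theses.AnyonJets
import Literature.Combinatorics.Enumerative.DeterminantAsPfaffian

/-!
# ValiantsHypothesis / AnyonJets — item `Resummation` (stmt-ValiantsHypothesis-16740)

`per_n = Σ_{k=0}^{C(n,2)} (−2)^k J_{n,k}` in `ℤ[x]`, where
`J_{n,k} = Σ_σ sgn σ · C(inv σ, k) · Π_i x_{σ(i), i}`: termwise
`sgn σ · Σ_k (−2)^k C(inv σ, k) = sgn σ · (1 − 2)^{inv σ} = (−1)^{inv σ} (−1)^{inv σ} = 1`
(`sgn σ = (−1)^{inv σ}`, tree `Pfaffian.cast_sign_eq_neg_one_pow`), and the binomial sum is complete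
because `inv σ ≤ C(n,2) = n(n−1)/2`. HONEST FRAMING: a combinatorial identity supporting a dormant
route; nothing here bears on `VP ≠ VNP`.
-/

-- layout Summits/ValiantsHypothesis/ValiantsHypothesis forces the duplicated namespace component
set_option linter.dupNamespace false

namespace Summit.ValiantsHypothesis.ValiantsHypothesis.Theorems.AnyonJets

open Literature.Computability.AlgebraicComplexity Literature.Combinatorics.Enumerative Finset

/-- The number of inversions of `σ ∈ S_n` is at most `n(n-1)/2`. [folklore] -/
theorem card_inversions_le {n : ℕ} (σ : Equiv.Perm (Fin n)) :
    (Pfaffian.inversions σ).card ≤ n * (n - 1) / 2 := by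
  classical
  have hN : n * (n - 1) / 2 = (powersetCard 2 (univ : Finset (Fin n))).card := by
    rw [card_powersetCard, card_univ, Fintype.card_fin, Nat.choose_two_right]
  rw [hN]
  have hmem : ∀ q : Fin n × Fin n, q ∈ Pfaffian.inversions σ ↔ q.1 < q.2 ∧ σ q.2 < σ q.1 := fun q => by
    simp [Pfaffian.inversions]
  refine Finset.card_le_card_of_injOn (fun q => {q.1, q.2}) (fun q hq => ?_) (fun q hq q' hq' h => ?_)
  · have hq' := (hmem q).1 (mem_coe.1 hq)
    rw [mem_coe]
    dsimp only
    rw [mem_powersetCard]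
    exact ⟨subset_univ _, card_pair hq'.1.ne⟩
  · rw [mem_coe, hmem] at hq hq'
    dsimp only at h
    have h1 : q.1 ∈ ({q'.1, q'.2} : Finset (Fin n)) := by rw [← h]; simp
    have h2 : q.2 ∈ ({q'.1, q'.2} : Finset (Fin n)) := by rw [← h]; simp
    simp only [mem_insert, mem_singleton] at h1 h2
    obtain ⟨a, b⟩ := q
    obtain ⟨a', b'⟩ := q'
    simp only at hq hq' h1 h2 ⊢
    rcases h1 with h1 | h1 <;> rcases h2 with h2 | h2
    · exact absurd (h1.trans h2.symm) hq.1.ne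
    · rw [h1, h2]
    · rw [h1, h2] at hq; exact absurd (hq.1.trans hq'.1) (lt_irrefl _)
    · exact absurd (h1.trans h2.symm) hq.1.ne

/-- The complete binomial sum `Σ_{k<N} (−2)^k C(m,k) = (−1)^m` for `m < N`. [folklore] -/
theorem sum_neg_two_pow_mul_choose {m N : ℕ} (h : m < N) :
    ∑ k ∈ range N, (-2 : ℤ) ^ k * (m.choose k : ℤ) = (-1) ^ m := by
  have hsplit : ∑ k ∈ range N, (-2 : ℤ) ^ k * (m.choose k : ℤ) =
      ∑ k ∈ range (m + 1), (-2 : ℤ) ^ k * (m.choose k : ℤ) := by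
    rw [← Finset.sum_range_add_sum_Ico _ (show m + 1 ≤ N by omega)]
    rw [Finset.sum_eq_zero (s := Ico (m + 1) N) fun k hk => by
      rw [Nat.choose_eq_zero_of_lt (by rw [mem_Ico] at hk; omega)]; simp]
    rw [add_zero]
  rw [hsplit]
  have := (add_pow (-2 : ℤ) 1 m).symm
  simp only [one_pow, mul_one] at this
  rw [this]; norm_num

/-- **Item `Resummation` (stmt-ValiantsHypothesis-16740):** `per_n = Σ_k (−2)^k J_{n,k}`.
[folklore] -/
theorem resummation_proof : Theses.AnyonJets.Resummation := by
  unfold Theses.AnyonJets.Resummation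
  intro J n
  dsimp only [J]
  classical
  -- swap the sums and collect the scalar per permutation
  simp only [Finset.smul_sum]
  rw [Finset.sum_comm]
  have hterm : ∀ σ : Equiv.Perm (Fin n),
      (∑ k ∈ range (n * (n - 1) / 2 + 1), ((-2 : ℤ) ^ k) •
        (MvPolynomial.C (((Equiv.Perm.sign σ : ℤˣ) : ℤ) *
          (((Finset.univ.filter (fun p : Fin n × Fin n => p.1 < p.2 ∧ σ p.2 < σ p.1)).card.choose k : ℕ) : ℤ)) *
          ∏ i : Fin n, MvPolynomial.X (σ i, i) : MvPolynomial (Fin n × Fin n) ℤ)) =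
      ∏ i : Fin n, MvPolynomial.X (σ i, i) := by
    intro σ
    have hinv : (Finset.univ.filter (fun p : Fin n × Fin n => p.1 < p.2 ∧ σ p.2 < σ p.1)) =
        Pfaffian.inversions σ := rfl
    simp_rw [MvPolynomial.smul_eq_C_mul, ← mul_assoc, ← MvPolynomial.C_mul, ← Finset.sum_mul,
      ← map_sum]
    rw [hinv]
    have hscalar : ∑ k ∈ range (n * (n - 1) / 2 + 1), (-2 : ℤ) ^ k *
        (((Equiv.Perm.sign σ : ℤˣ) : ℤ) * (((Pfaffian.inversions σ).card.choose k : ℕ) : ℤ)) = 1 := by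
      have hcomm : ∀ k, (-2 : ℤ) ^ k * (((Equiv.Perm.sign σ : ℤˣ) : ℤ) *
          (((Pfaffian.inversions σ).card.choose k : ℕ) : ℤ)) =
          ((Equiv.Perm.sign σ : ℤˣ) : ℤ) * ((-2 : ℤ) ^ k * (((Pfaffian.inversions σ).card.choose k : ℕ) : ℤ)) :=
        fun k => by ring
      simp_rw [hcomm, ← Finset.mul_sum]
      rw [sum_neg_two_pow_mul_choose (Nat.lt_succ_of_le (card_inversions_le σ))]
      have hs : (((Equiv.Perm.sign σ : ℤˣ) : ℤ) : ℤ) = (-1 : ℤ) ^ (Pfaffian.inversions σ).card :=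
        Pfaffian.cast_sign_eq_neg_one_pow σ
      rw [hs, ← pow_add, ← two_mul, pow_mul]; norm_num
    rw [hscalar, MvPolynomial.C_1, one_mul]
  simp_rw [hterm]
  -- the permanent
  unfold perPoly Matrix.permanent
  refine Finset.sum_congr rfl fun σ _ => Finset.prod_congr rfl fun i _ => ?_
  simp [Matrix.mvPolynomialX_apply]

end Summit.ValiantsHypothesis.ValiantsHypothesis.Theorems.AnyonJets
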